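import Summits.CriticalPhenomena.CardyFormulaZ2.Cruxes.HalfStripCardyZ2.Necessity

/-!
# Strategy census (Lean record) — crux `HalfStripCardyZ2` (stmt-CriticalPhenomena-5178), redirect strategist r1

Companion of `STRATEGY-CENSUS.md` (same directory). Every typed claim of the census is a checked theorem here
(namespace `Summit.CriticalPhenomena.CardyFormulaZ2.Cruxes.HalfStripCardyZ2.StrategyCensus`, cited `SC.<name>`):

* §0 frame — `SC.costume : UniqueConformalLimit → (HalfStripCardyZ2 ↔ CardyFormulaZ2)` and
  `SC.conjunct_split : CardyFormulaZ2 ↔ HalfStripCardyZ2 ∧ UniqueConformalLimit` (from `Necessity.lean`),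
  `SC.crux_of_summit`, `SC.below_crux` (what the crux implies in the tree: C⁺ = 5661, 9321, 5662, 0746).
* Decomposition D1 — the best typed split found: `HSConformal` (conformal EQUIVARIANCE of the half-strip
  limits: admissible mark tuples with equal modulus have asymptotically equal crossing probabilities) and
  `HSProfileDiag` (Cardy's PROFILE on the symmetric one-parameter family `ξ = (0, t, 1-t, 1)`, which realises
  every modulus, `SC.exists_diag_of_mem_Ioo`), with the glue `SC.crux_of_conformal_of_profileDiag` PROVED and
  both pieces consequences of the crux (`SC.conformal_of_crux`, `SC.profileDiag_of_crux`).
* Decomposition D2 — the route's own split is the crux relabelled: `SC.universality_iff_crux :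
  HalfStripCardyT → (HalfStripUniversality ↔ HalfStripCardyZ2)` (and `HalfStripCardyT` is theorem-grade:
  Smirnov's theorem is the tree fact `hasCrossingLimit_triDomainCrossingProb_holds`).
* Strengthening S2 — the rate form `HSRate` and `SC.crux_of_rate` (glue proved; no recursion in `N` exists).
* Negation — `SC.not_summit_of_not_crux` (a counterexample to the crux refutes the conjunct).
-/

noncomputable section

namespace Summit.CriticalPhenomena.CardyFormulaZ2.Cruxes.HalfStripCardyZ2.StrategyCensus

open Set Filter MeasureTheory
open Literature.Probability.RandomPlanarGeometry
open Literature.Probability.Percolation (hasCrossingLimit_triDomainCrossingProb_holds)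
open Summit.CriticalPhenomena.CardyFormulaZ2.Theses.CardyPerronTeleport
  (HalfStripCardyZ2 UniqueConformalLimit HalfStripUniversality HalfStripCardyT HalfStripRigidity HalfStripGlue)
open Summit.CriticalPhenomena.CardyFormulaZ2.Cruxes.HalfStripCardyZ2.Necessity
open Summit.CriticalPhenomena.CardyFormulaZ2.Cruxes.HalfPlaneMarkDensityLaw.SketchLine
  (halfStripGlue halfStripRigidity collinearCardy_of_halfStripCardyZ2 halfPlaneMarkDensityLaw_of_halfStripCardyZ2
    halfPlaneWiredCardy_of_halfStripCardyZ2 halfPlaneOneArmThird_of_halfStripCardyZ2 cardyRigidity_of_halfStripCardyZ2)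
open scoped Topology

/-! ## §0 Frame: the crux is the conjunct modulo the route's residual -/

/-- **Costume theorem.** Modulo the route's declared residual `X_U = UniqueConformalLimit`, the deciding crux
is the conjunct: `X_U → (HalfStripCardyZ2 ↔ CardyFormulaZ2)`. [folklore] -/
theorem costume (hU : UniqueConformalLimit) : HalfStripCardyZ2 ↔ _root_.CardyFormulaZ2 :=
  halfStripCardyZ2_iff_cardyFormulaZ2_of_uniqueConformalLimit hU

/-- **Conjunct split.** `CardyFormulaZ2 ↔ HalfStripCardyZ2 ∧ UniqueConformalLimit`: the two open binders of
`closes` are jointly equivalent to the conjunct. [folklore] -/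
theorem conjunct_split : _root_.CardyFormulaZ2 ↔ (HalfStripCardyZ2 ∧ UniqueConformalLimit) :=
  cardyFormulaZ2_iff_halfStripCardyZ2_and_uniqueConformalLimit

/-- The crux is a CONSEQUENCE of the conjunct (`S → C`, this seat). [folklore] -/
theorem crux_of_summit : _root_.CardyFormulaZ2 → HalfStripCardyZ2 :=
  halfStripCardyZ2_of_cardyFormulaZ2

/-- The third binder of `closes` is a tree theorem (stmt-5181), so `closes` needs exactly the two cruxes.
[folklore] -/
theorem rigidity_is_theorem : HalfStripRigidity := halfStripRigidity

/-- **What hangs below the crux in the tree**: half-strip Cardy implies the collinear half-plane Cardy law C⁺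
(⟺ stmt-5661 `HalfPlaneMarkDensityLaw`), the half-plane wired Cardy law (stmt-9321), the half-plane one-arm
exponent `1/3` (stmt-5662) and `CardyRigidity` (stmt-0746). Every strategy for the crux is a strategy for each
of these; the 5661 census found none short of the summit for C⁺. [folklore] -/
theorem below_crux :
    (HalfStripCardyZ2 → Summit.CriticalPhenomena.CardyFormulaZ2.Theses.CardyBoundaryCoulombGas.HalfPlaneMarkDensityLaw) ∧
    (HalfStripCardyZ2 → Summit.CriticalPhenomena.CardyFormulaZ2.Theses.CardyTotalPositivity.HalfPlaneWiredCardy) ∧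
    (HalfStripCardyZ2 → Summit.CriticalPhenomena.CardyFormulaZ2.Theses.CardyBoundaryCoulombGas.HalfPlaneOneArmThird) ∧
    (HalfStripCardyZ2 → Summit.CriticalPhenomena.CardyFormulaZ2.Theses.CardyUniqueLimit.CardyRigidity) :=
  ⟨halfPlaneMarkDensityLaw_of_halfStripCardyZ2, halfPlaneWiredCardy_of_halfStripCardyZ2,
    halfPlaneOneArmThird_of_halfStripCardyZ2, cardyRigidity_of_halfStripCardyZ2⟩

/-! ## Decomposition D2: the route's own split is the crux relabelled -/

/-- **`HalfStripCardyT → (HalfStripUniversality ↔ HalfStripCardyZ2)`.** Given the (theorem-grade) support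
`HalfStripCardyT` — Smirnov's theorem, a tree fact, read on `𝕋` half-strips — the route's rank-2 crux
`HalfStripUniversality` is EQUIVALENT to the deciding crux: `→` is the tree's `halfStripGlue`, `←` is
`(P^{ℤ²}_N → F) - (P^{𝕋}_N → F)`. [folklore] -/
theorem universality_iff_crux (hT : HalfStripCardyT) : HalfStripUniversality ↔ HalfStripCardyZ2 := by
  constructor
  · intro hU
    exact halfStripGlue hU hT
  · intro hC ξ hξ h0 h3
    have ht := hT hasCrossingLimit_triDomainCrossingProb_holds ξ hξ h0 h3
    have := (hC ξ hξ h0 h3).sub ht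
    rwa [sub_self] at this

/-! ## Decomposition D1: conformal equivariance + profile on one family -/

/-- Piece 1 (**conformal equivariance of the half-strip limits**): two admissible mark tuples with the same
modulus `crossRatio(-cos πξᵢ)` have asymptotically equal half-strip crossing probabilities. It carries the
conformal content and asserts no value. [folklore] -/
def HSConformal : Prop :=
  ∀ ξ ξ' : Fin 4 → ℝ, StrictMono ξ → 0 ≤ ξ 0 → ξ 3 ≤ 1 → StrictMono ξ' → 0 ≤ ξ' 0 → ξ' 3 ≤ 1 →
    crossRatio (negCos ξ) = crossRatio (negCos ξ') →
      Tendsto (fun N : ℕ => hsProb ξ N - hsProb ξ' N) atTop (𝓝 0)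

/-- The symmetric marks `(0, t, 1-t, 1)`. [folklore] -/
def diagMarks (t : ℝ) : Fin 4 → ℝ := ![0, t, 1 - t, 1]

/-- Piece 2 (**Cardy's profile on the symmetric family**): for `0 < t < 1/2`, the half-strip crossing
probability between the corner arcs `[0, ⌊tN⌋]` and `[⌊(1-t)N⌋, N]` tends to `F(tan⁴(πt/2))`. It carries the
value on one one-parameter family that realises every modulus. [folklore] -/
def HSProfileDiag : Prop :=
  ∀ t : ℝ, 0 < t → t < 1 / 2 →
    Tendsto (hsProb (diagMarks t)) atTop (𝓝 (cardyFunction (crossRatio (negCos (diagMarks t)))))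

/-- The symmetric marks are admissible. [folklore] -/
theorem diagMarks_admissible {t : ℝ} (ht0 : 0 < t) (ht1 : t < 1 / 2) :
    StrictMono (diagMarks t) ∧ 0 ≤ diagMarks t 0 ∧ diagMarks t 3 ≤ 1 := by
  refine ⟨Fin.strictMono_iff_lt_succ.2 fun i => ?_, by simp [diagMarks], by simp [diagMarks]⟩
  fin_cases i <;> simp [diagMarks] <;> linarith

/-- The modulus of the symmetric family: `crossRatio(-cos π·(0,t,1-t,1)) = ((1 - cos πt)/(1 + cos πt))²`.
[folklore] -/
theorem crossRatio_negCos_diagMarks (t : ℝ) :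
    crossRatio (negCos (diagMarks t)) =
      ((1 - Real.cos (Real.pi * t)) / (1 + Real.cos (Real.pi * t))) ^ 2 := by
  have e : crossRatio = fun x : Fin 4 → ℝ => (x 0 - x 1) * (x 2 - x 3) / ((x 0 - x 2) * (x 1 - x 3)) :=
    rfl
  have h0 : negCos (diagMarks t) 0 = -1 := by simp [negCos, diagMarks]
  have h1 : negCos (diagMarks t) 1 = -Real.cos (Real.pi * t) := by simp [negCos, diagMarks]
  have h2 : negCos (diagMarks t) 2 = Real.cos (Real.pi * t) := by
    simp only [negCos, diagMarks, Matrix.cons_val_two, Matrix.tail_cons, Matrix.head_cons]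
    rw [mul_sub, mul_one, Real.cos_pi_sub, neg_neg]
  have h3 : negCos (diagMarks t) 3 = 1 := by
    have : diagMarks t 3 = 1 := by simp [diagMarks]
    simp only [negCos, this, mul_one, Real.cos_pi, neg_neg]
  rw [e]
  simp only [h0, h1, h2, h3]
  rw [div_pow]
  congr 1 <;> ring

/-- Every modulus `η ∈ (0,1)` is realised by the symmetric family: `t = arccos((1-√η)/(1+√η))/π`. [folklore] -/
theorem exists_diag_of_mem_Ioo {η : ℝ} (hη : η ∈ Ioo (0 : ℝ) 1) :
    ∃ t : ℝ, 0 < t ∧ t < 1 / 2 ∧ crossRatio (negCos (diagMarks t)) = η := by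
  set s := Real.sqrt η with hs
  have hs0 : 0 < s := Real.sqrt_pos.2 hη.1
  have hs1 : s < 1 := by
    rw [hs, show (1 : ℝ) = Real.sqrt 1 by simp]
    exact Real.sqrt_lt_sqrt hη.1.le hη.2
  set c := (1 - s) / (1 + s) with hcdef
  have hc0 : 0 < c := div_pos (by linarith) (by linarith)
  have hc1 : c < 1 := by rw [hcdef, div_lt_one (by linarith)]; linarith
  have hπ := Real.pi_pos
  set t := Real.arccos c / Real.pi with htdef
  have hcos : Real.cos (Real.pi * t) = c := by
    rw [htdef, mul_div_cancel₀ _ hπ.ne']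
    exact Real.cos_arccos (by linarith) hc1.le
  have ht0 : 0 < t := div_pos (Real.arccos_pos.2 hc1) hπ
  have ht1 : t < 1 / 2 := by
    rw [htdef, div_lt_iff₀ hπ]
    have := Real.arccos_lt_pi_div_two.2 hc0
    linarith
  refine ⟨t, ht0, ht1, ?_⟩
  rw [crossRatio_negCos_diagMarks, hcos]
  have : (1 - c) / (1 + c) = s := by
    rw [hcdef]
    have : (1 + s) ≠ 0 := by positivity
    field_simp
    ring
  rw [this, hs, Real.sq_sqrt hη.1.le]

/-- **Glue of D1 (proved): `HSConformal → HSProfileDiag → HalfStripCardyZ2`.** [folklore] -/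
theorem crux_of_conformal_of_profileDiag (h1 : HSConformal) (h2 : HSProfileDiag) : HalfStripCardyZ2 := by
  rw [halfStripCardyZ2_iff]
  intro ξ hξ h0 h3
  have hη : crossRatio (negCos ξ) ∈ Ioo (0 : ℝ) 1 :=
    crossRatio_mem_Ioo (Or.inl (strictMono_negCos hξ h0 h3))
  obtain ⟨t, ht0, ht1, ht⟩ := exists_diag_of_mem_Ioo hη
  obtain ⟨hdm, hd0, hd3⟩ := diagMarks_admissible ht0 ht1
  have hdiff := h1 ξ (diagMarks t) hξ h0 h3 hdm hd0 hd3 ht.symm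
  have hlim := h2 t ht0 ht1
  rw [ht] at hlim
  have := hdiff.add hlim
  rw [zero_add] at this
  exact this.congr fun N => sub_add_cancel _ _

/-- Piece 1 is a consequence of the crux. [folklore] -/
theorem conformal_of_crux (hC : HalfStripCardyZ2) : HSConformal := by
  intro ξ ξ' hξ h0 h3 hξ' h0' h3' hη
  rw [halfStripCardyZ2_iff] at hC
  have hl : Tendsto (hsProb ξ) atTop (𝓝 (cardyFunction (crossRatio (negCos ξ)))) := hC ξ hξ h0 h3
  have hl' : Tendsto (hsProb ξ') atTop (𝓝 (cardyFunction (crossRatio (negCos ξ')))) := hC ξ' hξ' h0' h3'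
  rw [hη] at hl
  have h := hl.sub hl'
  rwa [sub_self] at h

/-- Piece 2 is a consequence of the crux. [folklore] -/
theorem profileDiag_of_crux (hC : HalfStripCardyZ2) : HSProfileDiag := by
  intro t ht0 ht1
  rw [halfStripCardyZ2_iff] at hC
  obtain ⟨hdm, hd0, hd3⟩ := diagMarks_admissible ht0 ht1
  exact hC _ hdm hd0 hd3

/-- **D1 both ways**: the crux is EQUIVALENT to the pair (conformal equivariance, profile on one family).
[folklore] -/
theorem crux_iff_conformal_and_profileDiag : HalfStripCardyZ2 ↔ (HSConformal ∧ HSProfileDiag) :=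
  ⟨fun h => ⟨conformal_of_crux h, profileDiag_of_crux h⟩, fun h => crux_of_conformal_of_profileDiag h.1 h.2⟩

/-! ## Strengthening S2: the rate form -/

/-- **S⁺ = the crux with a polynomial rate** (the form that could admit induction on scales). [folklore] -/
def HSRate : Prop :=
  ∃ θ : ℝ, 0 < θ ∧ ∀ ξ : Fin 4 → ℝ, StrictMono ξ → 0 ≤ ξ 0 → ξ 3 ≤ 1 → ∃ A : ℝ, ∀ᶠ N : ℕ in atTop,
    |hsProb ξ N - cardyFunction (crossRatio (negCos ξ))| ≤ A * (N : ℝ) ^ (-θ)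

/-- `HSRate → HalfStripCardyZ2` (squeeze). [folklore] -/
theorem crux_of_rate (h : HSRate) : HalfStripCardyZ2 := by
  rw [halfStripCardyZ2_iff]
  intro ξ hξ h0 h3
  obtain ⟨θ, hθ, hr⟩ := h
  obtain ⟨A, hA⟩ := hr ξ hξ h0 h3
  have hpow : Tendsto (fun N : ℕ => A * (N : ℝ) ^ (-θ)) atTop (𝓝 0) := by
    have := ((tendsto_rpow_neg_atTop hθ).comp tendsto_natCast_atTop_atTop).const_mul A
    simpa using this
  rw [tendsto_iff_norm_sub_tendsto_zero]
  refine squeeze_zero' (Eventually.of_forall fun N => norm_nonneg _) ?_ hpow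
  filter_upwards [hA] with N hN
  rwa [Real.norm_eq_abs]

/-! ## Negation -/

/-- A counterexample to the crux refutes the conjunct (and, below the crux, nothing: the crux sits ABOVE C⁺).
[folklore] -/
theorem not_summit_of_not_crux : ¬ HalfStripCardyZ2 → ¬ _root_.CardyFormulaZ2 :=
  not_cardyFormulaZ2_of_not_halfStripCardyZ2

end Summit.CriticalPhenomena.CardyFormulaZ2.Cruxes.HalfStripCardyZ2.StrategyCensus

end
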